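import Summits.CriticalPhenomena.PercolationContinuityZ3.Theorems.PercBoundarySqueezeAssembly
import Summits.CriticalPhenomena.PercolationContinuityZ3.Theorems.PercNonProliferationFreeBoxPowerSavingOfFatClusterMass
import Summits.CriticalPhenomena.PercolationContinuityZ3.Theorems.FreeBoxPowerSaving.Negative.FreeBoxPowerSavingLinearLRO
import Literature.Probability.Percolation.ConnectivityProofs
import Literature.Probability.Percolation.UniquenessZone

/-!
# Crux `PercBoundarySqueeze.FreeBoxFatClusterMass` (stmt-CriticalPhenomena-6982): logical status —
# the route needs the crux only in the jump branch; the unconditional crux carries an orthodox rate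

Helper file of the lead prover's line `registered` (skeleton `Cruxes/FreeBoxFatClusterMass/Lines/
registered.lean`, v2), landed `--supports stmt-CriticalPhenomena-6982`.  Everything is sorry-free and
uses only tree theorems.  Notation: `P = P_{p_c}` bond percolation on `ℤ³`, `Λ_R = box 3 R`,
`fat_R(x)` = "some finset `T` with `Nat.sqrt (R^3) ≤ #T` is joined to `x` inside `Λ_R`" (the event of
the crux), `θ = θ_0(p_c)`.

* `percolationContinuityZ3_of_not_theta_pos` — bookkeeping: `¬ 0 < θ(p_c) → θ(p_c) = 0`.
* `percolationContinuityZ3_of_halfSpaceOneArmRate_of_jump` — **the route's assembly needs the crux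
  only under the hypothesis `0 < θ(p_c)`**: `HalfSpaceOneArmRate → (0 < θ(p_c) → FreeBoxFatClusterMass)
  → PercolationContinuityZ3` (proof by contradiction over the proved `Assembly`).  Planning consequence:
  the item could be restated as the jump-conditional `0 < θ(p_c) → FreeBoxFatClusterMass` without
  touching the assembly; the unconditional form additionally contains an orthodox-world RATE statement
  (`confinedFatTail_of_freeBoxFatClusterMass` below) of the species "1/δ > 0 for finite critical
  clusters", open for `3 ≤ d ≤ 6` and not used anywhere in the route.
* `percolationContinuityZ3_of_polyScaleLRO_of_jump`, `…_of_linearScaleLRO_of_jump` — **a second and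
  third assembly for the same crux**: box long-range order at every polynomial scale
  (`PercFiniteBoxLRO.PolyScaleLROOfTheta`, stmt-0858) or at linear scale (`LinearScaleLROOfTheta`,
  stmt-0855) can replace `HalfSpaceOneArmRate`: composed from the tree edges
  `freeBoxPowerSaving_of_freeBoxFatClusterMass` (6982 ⟹ 4447) and
  `FreeBoxPowerSavingNegative.not_theta_pos_of_polyLRO / …_of_linearLRO`.
* `giantFatMass_of_freeBoxFatClusterMass` — the crux implies the line's registered stub B_∞
  (`stub_giantFatMass`: fat in-box pieces OF THE INFINITE CLUSTER carry `≤ C R^{3-δ}` mass), by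
  monotonicity; together with the skeleton (`A ∧ B_∞ ⟹ crux`) this brackets the crux between B_∞ and
  `A ∧ B_∞`, `A` = power-law upper tail of the finite critical cluster volume.
* `confinedFatTail_of_freeBoxFatClusterMass` — **the orthodox content of the unconditional crux**:
  `FreeBoxFatClusterMass ⟹ ∃ δ > 0, C: ∀ R ≥ 1, P(C(0) ⊆ Λ_{⌊R/2⌋} ∧ ⌊R^{3/2}⌋ ≤ |C(0)|) ≤ C R^{-δ}`
  (a finite cluster confined to the half-box around each `x ∈ Λ_{⌊R/2⌋}` is an in-box fat piece;
  translation invariance; `|Λ_{⌊R/2⌋}| ≥ R³/8`).  In the real world (`θ(p_c) = 0`, `d_f ≈ 2.52 > 3/2`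
  so the confinement is typical) this is a polynomial upper bound on the critical cluster-volume tail,
  of which nothing is in print for `ℤ³`.
-/

noncomputable section

namespace Summit.CriticalPhenomena.PercolationContinuityZ3.FreeBoxFatClusterMassLine

open MeasureTheory
open Literature.Probability.Percolation Literature.Probability.LatticeModels
open Summit.CriticalPhenomena.PercolationContinuityZ3.Theses.PercBoundarySqueeze
open Summit.CriticalPhenomena.PercolationContinuityZ3.Theses.PercFiniteBoxLRO (LinearScaleLROOfTheta
  PolyScaleLROOfTheta)
open scoped Classical BigOperators

/-! ## The route needs the crux only in the jump branch -/

/-- Bookkeeping: `θ(p_c) ≥ 0` is a probability, so `¬ 0 < θ(p_c)` is `θ(p_c) = 0`, i.e.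
`PercolationContinuityZ3`. -/
theorem percolationContinuityZ3_of_not_theta_pos
    (h : ¬ 0 < theta (zdGraph 3) (0 : Site 3) (criticalProbI 3)) : _root_.PercolationContinuityZ3 := by
  show theta (zdGraph 3) (0 : Site 3) (criticalProbI 3) = 0
  have h0 : 0 ≤ theta (zdGraph 3) (0 : Site 3) (criticalProbI 3) := measureReal_nonneg
  exact le_antisymm (not_lt.1 h) h0

/-- **The assembly by contradiction**: `HalfSpaceOneArmRate` and the JUMP-CONDITIONAL crux
`0 < θ(p_c) → FreeBoxFatClusterMass` already give `θ(p_c) = 0` (if `θ(p_c) > 0`, the conditional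
crux fires and the proved `Assembly` returns `θ(p_c) = 0`, absurd).  So the orthodox-world content of
the unconditional crux is never used by route `PercBoundarySqueeze`. -/
theorem percolationContinuityZ3_of_halfSpaceOneArmRate_of_jump :
    Summit.CriticalPhenomena.PercolationContinuityZ3.Theses.PercBoundarySqueeze.HalfSpaceOneArmRate →
      (0 < theta (zdGraph 3) (0 : Site 3) (criticalProbI 3) →
        Summit.CriticalPhenomena.PercolationContinuityZ3.Theses.PercBoundarySqueeze.FreeBoxFatClusterMass) →
      _root_.PercolationContinuityZ3 := by
  intro h1 h2
  by_contra hcon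
  refine hcon (Theorems.percBoundarySqueeze_assembly_proof h1 (h2 ?_))
  by_contra hθ
  exact hcon (percolationContinuityZ3_of_not_theta_pos hθ)

/-- **Second assembly for the crux**: box long-range order at every polynomial scale for percolating
`p` (`PolyScaleLROOfTheta`, stmt-CriticalPhenomena-0858) and the jump-conditional crux give
`θ(p_c) = 0` — via the tree edges `6982 ⟹ 4447` (`freeBoxPowerSaving_of_freeBoxFatClusterMass`) and
`0858 ∧ 4447 ⟹ ¬ 0 < θ(p_c)` (`FreeBoxPowerSavingNegative.not_theta_pos_of_polyLRO`). -/
theorem percolationContinuityZ3_of_polyScaleLRO_of_jump :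
    Summit.CriticalPhenomena.PercolationContinuityZ3.Theses.PercFiniteBoxLRO.PolyScaleLROOfTheta →
      (0 < theta (zdGraph 3) (0 : Site 3) (criticalProbI 3) →
        Summit.CriticalPhenomena.PercolationContinuityZ3.Theses.PercBoundarySqueeze.FreeBoxFatClusterMass) →
      _root_.PercolationContinuityZ3 := fun hP h2 =>
  percolationContinuityZ3_of_not_theta_pos fun hθ =>
    FreeBoxPowerSavingNegative.not_theta_pos_of_polyLRO hP
      (FreeBoxPowerSavingLine.freeBoxPowerSaving_of_freeBoxFatClusterMass (h2 hθ)) hθ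

/-- **Third assembly for the crux**: linear-scale box long-range order for percolating `p`
(`LinearScaleLROOfTheta`, stmt-CriticalPhenomena-0855) and the jump-conditional crux give
`θ(p_c) = 0` (`FreeBoxPowerSavingNegative.not_theta_pos_of_linearLRO` over `6982 ⟹ 4447`). -/
theorem percolationContinuityZ3_of_linearScaleLRO_of_jump :
    Summit.CriticalPhenomena.PercolationContinuityZ3.Theses.PercFiniteBoxLRO.LinearScaleLROOfTheta →
      (0 < theta (zdGraph 3) (0 : Site 3) (criticalProbI 3) →
        Summit.CriticalPhenomena.PercolationContinuityZ3.Theses.PercBoundarySqueeze.FreeBoxFatClusterMass) →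
      _root_.PercolationContinuityZ3 := fun hX h2 =>
  percolationContinuityZ3_of_not_theta_pos fun hθ =>
    FreeBoxPowerSavingNegative.not_theta_pos_of_linearLRO hX
      (FreeBoxPowerSavingLine.freeBoxPowerSaving_of_freeBoxFatClusterMass (h2 hθ)) hθ

/-! ## The crux implies the registered stub B_∞ -/

/-- **crux ⟹ B_∞** (`stub_giantFatMass` of the line's skeleton v2, verbatim): the event
`fat_R(x) ∧ |C(x)| = ∞` is contained in `fat_R(x)`. -/
theorem giantFatMass_of_freeBoxFatClusterMass :
    Summit.CriticalPhenomena.PercolationContinuityZ3.Theses.PercBoundarySqueeze.FreeBoxFatClusterMass →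
    ∃ δ C : ℝ, 0 < δ ∧ ∀ R : ℕ, 1 ≤ R →
      ∑ x ∈ box 3 R, (bondPercolation (zdGraph 3) (criticalProbI 3)).real
        {ω | (∃ T : Finset (Site 3), Nat.sqrt (R ^ 3) ≤ T.card ∧
            ∀ y ∈ T, ω ∈ openConnIn (↑(box 3 R) : Set (Site 3)) x y) ∧
          (openCluster ω x).Infinite}
        ≤ C * (R : ℝ) ^ ((3 : ℝ) - δ) := by
  rintro ⟨δ, C, hδ, h⟩
  refine ⟨δ, C, hδ, fun R hR => le_trans (Finset.sum_le_sum fun x _ => ?_) (h R hR)⟩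
  exact measureReal_mono fun ω hω => hω.1

/-! ## The orthodox content of the unconditional crux: a confined cluster-volume tail with a rate -/

/-- The confined fat-cluster event at `x`, written so that it is literally the translate of the
event at `0`: the cluster of `x`, translated back by `x`, lies in `Λ_k` and has `≥ n` vertices. -/
theorem confined_event_eq_preimage (k n : ℕ) (x : Site 3) :
    {ω : BondConfig (Site 3) | (fun y => y + -x) '' openCluster ω x ⊆ (↑(box 3 k) : Set (Site 3)) ∧
        (n : ℝ) ≤ (((fun y => y + -x) '' openCluster ω x).ncard : ℝ)} =
      BondConfig.relabel (sym2Equiv (Site.shift (-x))) ⁻¹'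
        {ω | openCluster ω (0 : Site 3) ⊆ (↑(box 3 k) : Set (Site 3)) ∧
          (n : ℝ) ≤ ((openCluster ω (0 : Site 3)).ncard : ℝ)} := by
  ext ω
  simp only [Set.mem_preimage, Set.mem_setOf_eq]
  have h := openCluster_relabel_shift (-x) ω x
  rw [add_neg_cancel] at h
  rw [h]

/-- **A confined fat cluster is a fat in-box piece (pointwise).**  If `x ∈ Λ_k`, `2k ≤ R`, the
cluster `C(x)` translated by `-x` lies in `Λ_k` and has `≥ n` vertices, then some finset `T` with
`n ≤ #T` is joined to `x` inside `Λ_R` (namely `T = C(x)`: every open path of the cluster stays in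
`x + Λ_k ⊆ Λ_R`). [folklore] -/
theorem fat_of_confined {k R n : ℕ} (hkR : 2 * k ≤ R) {x : Site 3} (hx : x ∈ box 3 k)
    {ω : BondConfig (Site 3)}
    (hω : (fun y => y + -x) '' openCluster ω x ⊆ (↑(box 3 k) : Set (Site 3)) ∧
      (n : ℝ) ≤ (((fun y => y + -x) '' openCluster ω x).ncard : ℝ)) :
    ∃ T : Finset (Site 3), n ≤ T.card ∧
      ∀ y ∈ T, ω ∈ openConnIn (↑(box 3 R) : Set (Site 3)) x y := by
  obtain ⟨hsub, hcard⟩ := hω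
  -- the cluster lies in `Λ_R`
  have hCR : openCluster ω x ⊆ (↑(box 3 R) : Set (Site 3)) := by
    intro y hy
    have hy' : y + -x ∈ box 3 k := Finset.mem_coe.1 (hsub ⟨y, hy, rfl⟩)
    rw [mem_box] at hy' hx
    refine Finset.mem_coe.2 (mem_box.2 fun i => ?_)
    have h1 := hy' i
    have h2 := hx i
    simp only [Pi.add_apply, Pi.neg_apply] at h1
    have hkR' : 2 * (k : ℤ) ≤ R := by exact_mod_cast hkR
    constructor <;> omega
  -- the cluster is finite, with `≥ n` vertices
  have hfinI : ((fun y => y + -x) '' openCluster ω x).Finite :=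
    (Finset.finite_toSet (box 3 k)).subset hsub
  have hfin : (openCluster ω x).Finite :=
    (Set.finite_image_iff (add_left_injective (-x)).injOn).1 hfinI
  have hncard : ((fun y => y + -x) '' openCluster ω x).ncard = (openCluster ω x).ncard :=
    Set.ncard_image_of_injective _ (add_left_injective (-x))
  refine ⟨hfin.toFinset, ?_, fun y hy => ?_⟩
  · have h1 : (n : ℝ) ≤ ((openCluster ω x).ncard : ℝ) := by rw [← hncard]; exact hcard
    have h2 : (openCluster ω x).ncard = hfin.toFinset.card := Set.ncard_eq_toFinset_card _ hfin
    rw [h2] at h1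
    exact_mod_cast h1
  · -- an open path from `x` to `y` runs inside the cluster, hence inside `Λ_R`
    have hyC : y ∈ openCluster ω x := hfin.mem_toFinset.1 hy
    obtain ⟨W⟩ := (show (openGraph ω).Reachable x y from hyC)
    refine DCT16.mem_openConnIn_of_pathIn (pathIn_of_walk_subset W fun z hz => hCR ?_)
    exact ⟨W.takeUntil z hz⟩

/-- **The orthodox content of the crux.**  `FreeBoxFatClusterMass` implies a polynomial upper bound
on the probability that the cluster of the origin is confined to `Λ_{⌊R/2⌋}` and has at least
`⌊R^{3/2}⌋` vertices: `P(C(0) ⊆ Λ_{⌊R/2⌋} ∧ Nat.sqrt (R^3) ≤ |C(0)|) ≤ C · R^{-δ}` for `R ≥ 1`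
(sum the translates over `x ∈ Λ_{⌊R/2⌋}`, each a fat in-box piece of `Λ_R`, and divide by
`|Λ_{⌊R/2⌋}| = (2⌊R/2⌋+1)³ ≥ R³`).  This statement is NOT vacuous when `θ(p_c) = 0` and no bound of
this kind is known for `ℤ³`; it is the part of the unconditional crux that the route never uses. -/
theorem confinedFatTail_of_freeBoxFatClusterMass :
    Summit.CriticalPhenomena.PercolationContinuityZ3.Theses.PercBoundarySqueeze.FreeBoxFatClusterMass →
    ∃ δ C : ℝ, 0 < δ ∧ ∀ R : ℕ, 1 ≤ R →
      (bondPercolation (zdGraph 3) (criticalProbI 3)).real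
        {ω | openCluster ω (0 : Site 3) ⊆ (↑(box 3 (R / 2)) : Set (Site 3)) ∧
          ((Nat.sqrt (R ^ 3) : ℕ) : ℝ) ≤ ((openCluster ω (0 : Site 3)).ncard : ℝ)}
        ≤ C * (R : ℝ) ^ (-δ) := by
  rintro ⟨δ, C, hδ, h⟩
  refine ⟨δ, max C 0, hδ, fun R hR => ?_⟩
  set μ := bondPercolation (zdGraph 3) (criticalProbI 3) with hμ
  set k := R / 2 with hk
  set E0 : Set (BondConfig (Site 3)) := {ω | openCluster ω (0 : Site 3) ⊆ (↑(box 3 k) : Set (Site 3)) ∧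
      ((Nat.sqrt (R ^ 3) : ℕ) : ℝ) ≤ ((openCluster ω (0 : Site 3)).ncard : ℝ)} with hE0
  have hρ1 : (1 : ℝ) ≤ R := by exact_mod_cast hR
  have hρ0 : (0 : ℝ) < R := by linarith
  have hkR : 2 * k ≤ R := by omega
  -- each translate has the probability of `E0` and is a fat piece
  have hterm : ∀ x ∈ box 3 k, μ.real E0 ≤ μ.real
      {ω | ∃ T : Finset (Site 3), Nat.sqrt (R ^ 3) ≤ T.card ∧
        ∀ y ∈ T, ω ∈ openConnIn (↑(box 3 R) : Set (Site 3)) x y} := by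
    intro x hx
    rw [← bondPercolation_real_preimage_shift (-x) (criticalProbI 3) E0, hE0,
      ← confined_event_eq_preimage k (Nat.sqrt (R ^ 3)) x]
    exact measureReal_mono fun ω hω => fat_of_confined hkR hx hω
  -- sum over the core and compare with the crux
  have hsum : ((box 3 k).card : ℝ) * μ.real E0 ≤ C * (R : ℝ) ^ ((3 : ℝ) - δ) :=
    calc ((box 3 k).card : ℝ) * μ.real E0 = ∑ x ∈ box 3 k, μ.real E0 := by
          rw [Finset.sum_const, nsmul_eq_mul]
      _ ≤ ∑ x ∈ box 3 k, μ.real {ω | ∃ T : Finset (Site 3), Nat.sqrt (R ^ 3) ≤ T.card ∧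
            ∀ y ∈ T, ω ∈ openConnIn (↑(box 3 R) : Set (Site 3)) x y} :=
          Finset.sum_le_sum hterm
      _ ≤ ∑ x ∈ box 3 R, μ.real {ω | ∃ T : Finset (Site 3), Nat.sqrt (R ^ 3) ≤ T.card ∧
            ∀ y ∈ T, ω ∈ openConnIn (↑(box 3 R) : Set (Site 3)) x y} :=
          Finset.sum_le_sum_of_subset_of_nonneg (box_mono 3 (Nat.div_le_self R 2))
            fun _ _ _ => measureReal_nonneg
      _ ≤ C * (R : ℝ) ^ ((3 : ℝ) - δ) := h R hR
  -- `|Λ_k| ≥ R³`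
  have hcard : (R : ℝ) ^ (3 : ℝ) ≤ ((box 3 k).card : ℝ) := by
    have h3 : (R : ℝ) ^ (3 : ℝ) = (R : ℝ) ^ (3 : ℕ) := by exact_mod_cast Real.rpow_natCast (R : ℝ) 3
    rw [card_box, h3]
    have hk2 : R ≤ 2 * k + 1 := by omega
    have hk2' : (R : ℝ) ≤ 2 * (k : ℝ) + 1 := by exact_mod_cast hk2
    push_cast
    exact pow_le_pow_left₀ hρ0.le hk2' 3
  have hR3 : (0 : ℝ) < (R : ℝ) ^ (3 : ℝ) := Real.rpow_pos_of_pos hρ0 3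
  have hE0nn : 0 ≤ μ.real E0 := measureReal_nonneg
  -- divide
  have hmain : (R : ℝ) ^ (3 : ℝ) * μ.real E0 ≤ max C 0 * (R : ℝ) ^ ((3 : ℝ) - δ) :=
    calc (R : ℝ) ^ (3 : ℝ) * μ.real E0 ≤ ((box 3 k).card : ℝ) * μ.real E0 :=
          mul_le_mul_of_nonneg_right hcard hE0nn
      _ ≤ C * (R : ℝ) ^ ((3 : ℝ) - δ) := hsum
      _ ≤ max C 0 * (R : ℝ) ^ ((3 : ℝ) - δ) :=
          mul_le_mul_of_nonneg_right (le_max_left _ _) (Real.rpow_nonneg hρ0.le _)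
  have hsplit : (R : ℝ) ^ ((3 : ℝ) - δ) = (R : ℝ) ^ (3 : ℝ) * (R : ℝ) ^ (-δ) := by
    rw [← Real.rpow_add hρ0]; ring_nf
  rw [hsplit] at hmain
  have : μ.real E0 ≤ max C 0 * (R : ℝ) ^ (-δ) := by
    have h' : (R : ℝ) ^ (3 : ℝ) * μ.real E0 ≤ (R : ℝ) ^ (3 : ℝ) * (max C 0 * (R : ℝ) ^ (-δ)) := by
      calc (R : ℝ) ^ (3 : ℝ) * μ.real E0 ≤ max C 0 * ((R : ℝ) ^ (3 : ℝ) * (R : ℝ) ^ (-δ)) := hmain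
        _ = (R : ℝ) ^ (3 : ℝ) * (max C 0 * (R : ℝ) ^ (-δ)) := by ring
    exact le_of_mul_le_mul_left h' hR3
  simpa [hE0, hk] using this

end Summit.CriticalPhenomena.PercolationContinuityZ3.FreeBoxFatClusterMassLine

end
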